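import Literature.NumberTheory.Automorphic.AutomorphicRepsGL
import Literature.NumberTheory.Automorphic.PairLFunctionBaseChange
import Literature.NumberTheory.GaloisRepresentations.HeckeCharacter
import HarnessLib

/-!
# Ramakrishnan (2000): modularity of the Rankin–Selberg product `GL(2) × GL(2) → GL(4)`
# (Theorem M) and multiplicity one for `SL(2)` (Theorem 4.1.2), as named facts

Topic `NumberTheory/Automorphic`; namespace `Literature.NumberTheory.Automorphic`. Two deep
results of D. Ramakrishnan, *Modularity of the Rankin–Selberg `L`-series, and multiplicity one
for `SL(2)`*, Ann. of Math. 152 (2000), 45–111 [Ramakrishnan2000], vendored as **named facts**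
(`def … : Prop`, D-0014) in the Borel–Jacquet model of the tree (`CuspidalAutomorphicRepData`,
`AutomorphicRepData.HasSatakeParamAt` of `AutomorphicRepsGL`), i.e. at the level of Satake
parameters at almost all finite places — the only local vocabulary of that model:

* `Ramakrishnan2000_theoremM` — **Theorem M** (op. cit. §3; announced in the Introduction): for
  cuspidal `π, π'` on `GL(2)/F` there is an (isobaric) automorphic
  representation `π ⊠ π'` of `GL(4, 𝔸_F)` with `L(s, (π ⊠ π')_v) = L(s, π_v × π'_v)` at every
  place; at a finite place where `π_v, π'_v` (and `(π ⊠ π')_v`) are unramified this says that the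
  Satake parameter of `π ⊠ π'` is the multiset of pairwise products `{αᵢ βⱼ}`
  (`satakeTensor α β`, accepted `PairLFunctionBaseChange`; op. cit. §3.1 (P1) and §3.7, proof of
  Theorem M: the unramified local components "correspond to … `σ_v ⊗ σ'_v`"). Vendored: the existence of an automorphic
  `Π` on `GL(4)` with these Satake parameters at almost all places, **and** the cuspidality
  criterion in the non-dihedral case: if neither `π` nor `π'` is dihedral, `π ⊠ π'` is cuspidal
  iff `π'` is not `π ⊗ χ` for any idele class character `χ` (condition (C)).
* `Ramakrishnan2000_multiplicityOneSL2` — **Theorem 4.1.2** (the statement on `GL(2)` from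
  which multiplicity one for `SL(2)`, Thm. 4.1.1, follows by Labesse–Langlands): if `π, π'`
  are cuspidal on `GL(2)/F` with `Ad(π_v) ≃ Ad(π'_v)` for almost all `v`, then `π' ≃ π ⊗ χ` for
  an idele class character `χ`.
* proved glue: `Ramakrishnan2000_theoremM.exists_cuspidal` (the useful direction of the
  criterion) and `Ramakrishnan2000_multiplicityOneSL2.of_adjoint` (the hypothesis of Thm. 4.1.2
  in its printed form, equality of the Langlands classes `{a/b, 1, b/a}` of `Ad(π_v)`,
  `Ad(π'_v)`, converted to the equivalent "`π'_v` is an unramified twist of `π_v`" form in which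
  the fact is stated — pure algebra of `2`-element multisets).

## Renderings (read before using the facts)

* *Isomorphism of automorphic representations.* The datum model has no notion of isomorphism
  other than through local data; "`π' ≃ π ⊗ χ`" is rendered by its Satake shadow "for almost
  all `v`, every Satake parameter `α` of `π` at `v` gives the Satake parameter `χ(ϖ_v) · α` of
  `π'` at `v`" (`HeckeCharacter.valueAtUniformizer`; for cuspidal `GL(2)` this is equivalent to
  `π' ≃ π ⊗ χ` by strong multiplicity one, Jacquet–Shalika 1981, which is *not* folded into the
  facts: hypotheses and conclusions are all almost-everywhere Satake statements, as in the
  tree's `ArthurClozel_fibres_quadratic`).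
* *Dihedral.* "`π` is associated to a character of a quadratic extension" (`π = I_K^F(μ)`) is
  rendered, through op. cit. Prop. 2.3.1 (2) ("the image of `I_{K/F}` consists precisely of those
  `π` with `π ≃ π ⊗ χ`", `χ = χ_{K/F}`), as "`π` admits a non-trivial self-twist": there is a
  Hecke character `δ ≠ 1` with `t_{π,v} = δ(ϖ_v) t_{π,v}` for almost all `v`
  (`IsSatakeSelfTwist`; such a `δ` is automatically quadratic, comparing central characters).
* *Cuspidality of `π ⊠ π'`* is rendered as "some **cuspidal** datum `Π` on `GL(4)/F` has the
  Satake parameters `{αᵢ βⱼ}` at almost all places" (for the isobaric `π ⊠ π'` the two are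
  equivalent by the rigidity of isobaric representations, Jacquet–Shalika 1981 = op. cit.
  Thm. 2.2.4, "unique up to equivalence").
* *Unitarity.* Ramakrishnan's cuspidal representations are unitary by convention (op. cit.
  §2.2); the tree's `CuspidalAutomorphicRepData` carry arbitrary central characters. Both
  theorems are insensitive to the unitary normalisation `π = π⁰ ⊗ |det|^s` (Borel–Jacquet 1979,
  5.7): Satake parameters scale by `q_v^{-s}`, `π ⊠ π' = (π⁰ ⊠ π'⁰) ⊗ |det|^{s+s'}`, and the
  twisting character `χ` of Thm. 4.1.2 becomes the quasi-character `χ⁰ |·|^{s'-s}` — which is why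
  `χ` is a `HeckeCharacter` (quasi-character, `GaloisRepresentations.HeckeCharacter`) and no
  unitarity of `χ` is asserted. This is the convention of `ArthurClozel_fibres_quadratic`
  (`TunnellLemma`).

## What is deliberately NOT here

* The identities `(L_v)`, `(ε_v)` of Theorem M at the ramified and archimedean places (no local
  `L`- and `ε`-factors of representations of `GL(4, F_v)` in the datum model), and the
  isobaric structure of `π ⊠ π'` (the tree has no isobaric sums).
* The dihedral case of the cuspidality criterion ("if `π' = I_K^F(μ)`, then `π ⊠ π'` is cuspidal
  iff `π_K` is cuspidal and `π_K ≄ π_K ⊗ (μ ∘ θ) μ⁻¹`"), which is phrased through the base change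
  `π_K`.
* The uniqueness of `χ` in Thm. 4.1.2 for non-dihedral `π`, and "if `π, π'` have the same central
  character then `χ` is quadratic" (the latter follows from the vendored statement by comparing
  `e₂` of the Satake parameters and `HeckeCharacter.ext_of_eventually_valueAtUniformizer_eq`).
* Theorem 4.1.1 itself (multiplicity one on `L²₀(SL(2, F) \ SL(2, 𝔸_F))`): the tree has no
  automorphic spectrum of `SL(2)`.

## References

* D. Ramakrishnan, *Modularity of the Rankin–Selberg `L`-series, and multiplicity one for
  `SL(2)`*, Ann. of Math. (2) 152 (2000), 45–111, doi:10.2307/2661379; Theorem M (§3),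
  Prop. 2.3.1, Prop. 3.2.1, Theorem 4.1.2 and its proof (§4.1, Lemma 4.1.4). [Ramakrishnan2000]
* H. Jacquet, J. Shalika, *On Euler products and the classification of automorphic forms
  I, II*, Amer. J. Math. 103 (1981). [JacquetShalika1981]
* A. Borel, H. Jacquet, *Automorphic forms and automorphic representations*, Proc. Sympos. Pure
  Math. 33 (1979), part 1, §4.6, 5.7. [BorelJacquet1979]
-/

noncomputable section

open scoped MatrixGroups Classical
open NumberField IsDedekindDomain

namespace Literature.NumberTheory.Automorphic

variable {n : ℕ} {F : Type} [Field F] [NumberField F] {hF : isCompact_glFiniteIntegralLevel n F}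

/-! ### Satake renderings of twists -/

/-- **`π'` is the twist `π ⊗ χ` at the level of Satake parameters**: for all but finitely many
finite places `v`, every Satake parameter `α = {αᵢ}` of `π` at `v` gives the Satake parameter
`{χ(ϖ_v) αᵢ}` of `π'` at `v` (`t_{π ⊗ χ, v} = χ(ϖ_v) t_{π,v}` at the unramified places of `π` and
`χ`: Arthur–Clozel 1989, Ch. 3, proof of Thm. 3.1; Ramakrishnan 2000, §2.2–2.3). For cuspidal
`π, π'` on `GL(n)` this is equivalent to `π' ≃ π ⊗ χ` by strong multiplicity one
(Jacquet–Shalika 1981), which is not folded in.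
[cite: ArthurClozelAMS120, Ch. 3, proof of Thm. 3.1 (p. 172)] -/
def IsSatakeTwistBy (π π' : AutomorphicRepData (AutomorphyDatum.gl n F hF))
    (χ : GaloisRepresentations.HeckeCharacter F) : Prop :=
  ∀ᶠ v : HeightOneSpectrum (𝓞 F) in Filter.cofinite, ∀ α : Multiset ℂ,
    π.HasSatakeParamAt v α → π'.HasSatakeParamAt v (α.map (χ.valueAtUniformizer v * ·))

/-- Unfolding lemma for `IsSatakeTwistBy`. [folklore] -/
theorem isSatakeTwistBy_iff (π π' : AutomorphicRepData (AutomorphyDatum.gl n F hF))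
    (χ : GaloisRepresentations.HeckeCharacter F) :
    IsSatakeTwistBy π π' χ ↔
      ∀ᶠ v : HeightOneSpectrum (𝓞 F) in Filter.cofinite, ∀ α : Multiset ℂ,
        π.HasSatakeParamAt v α → π'.HasSatakeParamAt v (α.map (χ.valueAtUniformizer v * ·)) :=
  Iff.rfl

/-- **`π` admits a non-trivial self-twist** (`π ≃ π ⊗ δ` for an idele class character `δ ≠ 1`,
at the level of Satake parameters almost everywhere). For cuspidal `π` on `GL(2)/F` this is
Ramakrishnan's "`π` is associated to a character `μ` of a quadratic extension `K`"
(`π = I_K^F(μ)`, *dihedral*), by op. cit. Prop. 2.3.1 (2): "The image of `I_{K/F}` consists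
precisely of those `π ∈ 𝒜(nℓ, F)` such that `π ≃ π ⊗ χ`" (`χ = χ_{K/F}`; a self-twisting `δ ≠ 1`
of a cuspidal `π` on `GL(2)` is quadratic, `ω_π = ω_π δ²`, hence of the form `χ_{K/F}`).
[cite: Ramakrishnan2000, Prop. 2.3.1 (2)] -/
def IsSatakeSelfTwist (π : AutomorphicRepData (AutomorphyDatum.gl n F hF)) : Prop :=
  ∃ δ : GaloisRepresentations.HeckeCharacter F, δ ≠ 1 ∧ IsSatakeTwistBy π π δ

/-- Unfolding lemma for `IsSatakeSelfTwist`. [folklore] -/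
theorem isSatakeSelfTwist_iff (π : AutomorphicRepData (AutomorphyDatum.gl n F hF)) :
    IsSatakeSelfTwist π ↔
      ∃ δ : GaloisRepresentations.HeckeCharacter F, δ ≠ 1 ∧ IsSatakeTwistBy π π δ :=
  Iff.rfl

/-- The trivial character twists `π` to itself: `IsSatakeTwistBy π π 1`
(`1(ϖ_v) = 1`, `{1 · αᵢ} = {αᵢ}`). [folklore] -/
theorem isSatakeTwistBy_one_self (π : AutomorphicRepData (AutomorphyDatum.gl n F hF)) :
    IsSatakeTwistBy π π 1 := by
  refine Filter.Eventually.of_forall fun v α hα => ?_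
  have h1 : (1 : GaloisRepresentations.HeckeCharacter F).valueAtUniformizer v = 1 := by
    simp only [GaloisRepresentations.HeckeCharacter.valueAtUniformizer,
      GaloisRepresentations.HeckeCharacter.localComponent_apply]
    rfl
  simpa [h1] using hα

/-! ### Theorem M -/

/-- **Ramakrishnan's Theorem M** (modularity of the Rankin–Selberg product
`⊠ : 𝒜(GL(2)) × 𝒜(GL(2)) → 𝒜(GL(4))`; op. cit. §3, Theorem M: "Let `π, π'` be in `𝒜(2, F)`.
*Existence*: There exists an isobaric automorphic representation `π ⊠ π'` of `GL(4, 𝔸_F)`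
satisfying (at every finite place `v`) `L(s, (π ⊠ π')_v) = L(s, π_v × π'_v)` and
`ε(s, (π ⊠ π')_v) = ε(s, π_v × π'_v)` (and `(L_∞)`). *Cuspidality criterion*: Suppose `π, π'` are
both cuspidal. If neither of them is associated to a character of a quadratic extension, then
`π ⊠ π'` is cuspidal iff (C) `π'` is not equivalent to `π ⊗ χ`, for any idele class character `χ`
of `F`"), **for cuspidal `π, π'`, at the level of Satake parameters almost everywhere** (at an
unramified place `L(s, π_v × π'_v) = det(1 - A_v(π) ⊗ A_v(π') q_v^{-s})⁻¹`, so the Satake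
parameter of `π ⊠ π'` at `v` is `satakeTensor α β = {αᵢ βⱼ}`; op. cit. §3.1 (P1), §3.7).
For every number field `F` and cuspidal automorphic representations `π, π'` of `GL(2, 𝔸_F)`
(Borel–Jacquet data, arbitrary central characters — see the module docstring, *Unitarity*):
(i) there is an automorphic representation `Π` of `GL(4, 𝔸_F)` such that for almost all finite
`v`, Satake parameters `α` of `π` and `β` of `π'` at `v` give the Satake parameter `{αᵢ βⱼ}` of `Π`
at `v`; (ii) if neither `π` nor `π'` admits a non-trivial self-twist (`IsSatakeSelfTwist`, the
rendering of "dihedral" through op. cit. Prop. 2.3.1 (2)), then such a `Π` can be taken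
**cuspidal** iff `π'` is not a twist `π ⊗ χ` of `π` by a Hecke character (`IsSatakeTwistBy`).
The dihedral case of the criterion and the local identities at the remaining places are not
vendored (module docstring). Named fact (D-0014). [cite: Ramakrishnan2000, Theorem M (§3) with Prop. 3.2.1] -/
def Ramakrishnan2000_theoremM : Prop :=
  ∀ (F : Type) [Field F] [NumberField F]
    (h2 : isCompact_glFiniteIntegralLevel 2 F) (h4 : isCompact_glFiniteIntegralLevel 4 F)
    (π π' : CuspidalAutomorphicRepData 2 F h2),
    (∃ P : AutomorphicRepData (AutomorphyDatum.gl 4 F h4),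
      ∀ᶠ v : HeightOneSpectrum (𝓞 F) in Filter.cofinite, ∀ α β : Multiset ℂ,
        π.1.HasSatakeParamAt v α → π'.1.HasSatakeParamAt v β →
          P.HasSatakeParamAt v (satakeTensor α β)) ∧
    (¬ IsSatakeSelfTwist π.1 → ¬ IsSatakeSelfTwist π'.1 →
      ((∃ P : CuspidalAutomorphicRepData 4 F h4,
        ∀ᶠ v : HeightOneSpectrum (𝓞 F) in Filter.cofinite, ∀ α β : Multiset ℂ,
          π.1.HasSatakeParamAt v α → π'.1.HasSatakeParamAt v β →
            P.1.HasSatakeParamAt v (satakeTensor α β)) ↔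
      ¬ ∃ χ : GaloisRepresentations.HeckeCharacter F, IsSatakeTwistBy π.1 π'.1 χ))

/-- **The useful direction of the cuspidality criterion** (op. cit. Theorem M with Prop. 3.2.1,
"Conversely, suppose that `π, π'` are cuspidal and (C) holds … so `π ⊠ π'` must be cuspidal"):
granting `Ramakrishnan2000_theoremM`, two cuspidal `π, π'` on `GL(2)/F` without non-trivial
self-twists and not twists of each other have a **cuspidal** `Π` on `GL(4)/F` with Satake
parameters `{αᵢ βⱼ}` almost everywhere. [cite: Ramakrishnan2000, Theorem M and Prop. 3.2.1] -/
theorem Ramakrishnan2000_theoremM.exists_cuspidal (h : Ramakrishnan2000_theoremM)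
    (h2 : isCompact_glFiniteIntegralLevel 2 F) (h4 : isCompact_glFiniteIntegralLevel 4 F)
    (π π' : CuspidalAutomorphicRepData 2 F h2) (hπ : ¬ IsSatakeSelfTwist π.1)
    (hπ' : ¬ IsSatakeSelfTwist π'.1)
    (hC : ¬ ∃ χ : GaloisRepresentations.HeckeCharacter F, IsSatakeTwistBy π.1 π'.1 χ) :
    ∃ P : CuspidalAutomorphicRepData 4 F h4,
      ∀ᶠ v : HeightOneSpectrum (𝓞 F) in Filter.cofinite, ∀ α β : Multiset ℂ,
        π.1.HasSatakeParamAt v α → π'.1.HasSatakeParamAt v β →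
          P.1.HasSatakeParamAt v (satakeTensor α β) :=
  ((h F h2 h4 π π').2 hπ hπ').mpr hC

/-! ### Theorem 4.1.2: multiplicity one for `SL(2)`, in its `GL(2)` form -/

/-- **Ramakrishnan's Theorem 4.1.2** (the `GL(2)` statement behind multiplicity one for `SL(2)`,
Thm. 4.1.1, via Labesse–Langlands; op. cit. §4.1: "Let `π, π'` be unitary, cuspidal automorphic
representations of `GL(2, 𝔸_F)`. Suppose we have, for almost all `v`, `(LL(v))`
`Ad(π_v) ≃ Ad(π'_v)`. Then there exists an idele class character `χ`, which is unique if `π` is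
not automorphically induced by a character of a quadratic extension, such that `π' ≃ π ⊗ χ`. If
`π` and `π'` have the same central character, then `χ` is quadratic." Here `Ad(π) = sym²(π) ⊗ ω⁻¹`
on `GL(3)/F`), **at the level of Satake parameters almost everywhere.** At an unramified place,
with `A_v(π) = diag(a, b)`, the Langlands class of `Ad(π_v)` is `{a/b, 1, b/a}` (op. cit. proof
of Cor. 4.1.3), so `(LL(v))` says `{a/b, 1, b/a} = {a'/b', 1, b'/a'}`, i.e. `{a', b'} = c · {a, b}`
for some `c ∈ ℂˣ` (`π'_v` is an unramified twist of `π_v`; the conversion is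
`Ramakrishnan2000_multiplicityOneSL2.of_adjoint`). Statement: for every number field `F` and
cuspidal automorphic representations `π, π'` of `GL(2, 𝔸_F)` (Borel–Jacquet data, arbitrary
central characters — module docstring, *Unitarity*): if for almost all finite `v` there are a
Satake parameter `α` of `π` at `v` and `c ≠ 0` with `c · α` a Satake parameter of `π'` at `v`,
then there is a Hecke character `χ` of `F` with `t_{π',v} = χ(ϖ_v) t_{π,v}` for almost all `v`
(`IsSatakeTwistBy π π' χ`). Uniqueness of `χ` and the quadratic clause are not vendored.
Named fact (D-0014). [cite: Ramakrishnan2000, Theorem 4.1.2] -/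
def Ramakrishnan2000_multiplicityOneSL2 : Prop :=
  ∀ (F : Type) [Field F] [NumberField F] (h2 : isCompact_glFiniteIntegralLevel 2 F)
    (π π' : CuspidalAutomorphicRepData 2 F h2),
    (∀ᶠ v : HeightOneSpectrum (𝓞 F) in Filter.cofinite, ∃ (α : Multiset ℂ) (c : ℂ), c ≠ 0 ∧
        π.1.HasSatakeParamAt v α ∧ π'.1.HasSatakeParamAt v (α.map (c * ·))) →
    ∃ χ : GaloisRepresentations.HeckeCharacter F, IsSatakeTwistBy π.1 π'.1 χ

/-- Two-element multisets with the same "adjoint class": if `a, b, a', b'` are non-zero and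
`{a/b, 1, b/a} = {a'/b', 1, b'/a'}` then `{a', b'} = {c a, c b}` for some `c ≠ 0` (namely
`c = a'/a` if `a'/b' = a/b`, and `c = a'/b` if `a'/b' = b/a`). [folklore] -/
theorem exists_pair_eq_map_mul_of_adjoint_eq {a b a' b' : ℂ} (ha : a ≠ 0) (hb : b ≠ 0)
    (ha' : a' ≠ 0) (hb' : b' ≠ 0)
    (h : ({a / b, 1, b / a} : Multiset ℂ) = {a' / b', 1, b' / a'}) :
    ∃ c : ℂ, c ≠ 0 ∧ ({a', b'} : Multiset ℂ) = ({a, b} : Multiset ℂ).map (c * ·) := by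
  -- cancel the common entry `1`
  have h2 : ({a / b, b / a} : Multiset ℂ) = {a' / b', b' / a'} := by
    simp only [Multiset.insert_eq_cons] at h ⊢
    rw [Multiset.cons_swap (a / b) 1, Multiset.cons_swap (a' / b') 1] at h
    exact (Multiset.cons_inj_right _).mp h
  have hmem : a' / b' ∈ ({a / b, b / a} : Multiset ℂ) := by
    rw [h2]; exact Multiset.mem_cons_self _ _
  simp only [Multiset.insert_eq_cons, Multiset.mem_cons, Multiset.mem_singleton] at hmem
  rcases hmem with h1 | h1
  · -- `a'/b' = a/b`: `c = a'/a`
    have key : a' * b = a * b' := (div_eq_div_iff hb' hb).mp h1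
    refine ⟨a' / a, div_ne_zero ha' ha, ?_⟩
    have hcb : a' / a * b = b' := by
      rw [div_mul_eq_mul_div, div_eq_iff ha]
      linear_combination key
    rw [show ({a, b} : Multiset ℂ).map (a' / a * ·) = {a' / a * a, a' / a * b} by simp, hcb,
      div_mul_cancel₀ a' ha]
  · -- `a'/b' = b/a`: `c = a'/b`, and `{a', b'} = {c b, c a} = {c a, c b}`
    have key : a' * a = b * b' := (div_eq_div_iff hb' ha).mp h1
    refine ⟨a' / b, div_ne_zero ha' hb, ?_⟩
    have hca : a' / b * a = b' := by
      rw [div_mul_eq_mul_div, div_eq_iff hb]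
      linear_combination key
    rw [show ({a, b} : Multiset ℂ).map (a' / b * ·) = {a' / b * a, a' / b * b} by simp, hca,
      div_mul_cancel₀ a' hb]
    exact Multiset.pair_comm a' b'

/-- **Theorem 4.1.2 from its printed hypothesis.** Granting `Ramakrishnan2000_multiplicityOneSL2`:
if for almost all finite `v` the cuspidal `π, π'` on `GL(2)/F` have Satake parameters `{a, b}`,
`{a', b'}` at `v` (non-zero) with the same Langlands class of the adjoint,
`{a/b, 1, b/a} = {a'/b', 1, b'/a'}` (`(LL(v))`: `Ad(π_v) ≃ Ad(π'_v)`), then `π'` is a twist of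
`π` by a Hecke character at the level of Satake parameters almost everywhere.
[cite: Ramakrishnan2000, Theorem 4.1.2] -/
theorem Ramakrishnan2000_multiplicityOneSL2.of_adjoint (h : Ramakrishnan2000_multiplicityOneSL2)
    (h2 : isCompact_glFiniteIntegralLevel 2 F) (π π' : CuspidalAutomorphicRepData 2 F h2)
    (hLL : ∀ᶠ v : HeightOneSpectrum (𝓞 F) in Filter.cofinite, ∃ a b a' b' : ℂ,
      a ≠ 0 ∧ b ≠ 0 ∧ a' ≠ 0 ∧ b' ≠ 0 ∧
        π.1.HasSatakeParamAt v {a, b} ∧ π'.1.HasSatakeParamAt v {a', b'} ∧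
          ({a / b, 1, b / a} : Multiset ℂ) = {a' / b', 1, b' / a'}) :
    ∃ χ : GaloisRepresentations.HeckeCharacter F, IsSatakeTwistBy π.1 π'.1 χ := by
  refine h F h2 π π' (hLL.mono fun v hv => ?_)
  obtain ⟨a, b, a', b', ha, hb, ha', hb', hπ, hπ', hAd⟩ := hv
  obtain ⟨c, hc, hab⟩ := exists_pair_eq_map_mul_of_adjoint_eq ha hb ha' hb' hAd
  exact ⟨{a, b}, c, hc, hπ, by rw [← hab]; exact hπ'⟩

end Literature.NumberTheory.Automorphic

end
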